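import Summits.CriticalPhenomena.PercolationContinuityZ3.Theorems.Transplant.BoxProdZ2CubeInputs
import HarnessLib

/-!
# The per-contact Step-IV input `hIV` of p2's `KNLevels.targetLemma_of_kits` for the `X □ ℤ²` thick-seed kit, from the target route `h3`
# (BLUEPRINT-I-PHI §1 row "Lemma 10, Step IV"; the glue between `BoxProdZ2CubeInputs` (h1, h2 under `P_p`) and `KNLevels.stepIV_in`)

builds on p205010 (kernel theorem, internal audit signed; external expert review pending) — nothing in this file uses p205010.
Lane `prim-bschramm`, seat `prim-bschramm-p3` (Φ3-prod / CubeInputs wiring); helper file (`--supports stmt-CriticalPhenomena-4575 --as helper`).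

`stepIV_inputs_at` (p3) gives, at every candidate contact `x` of a wide tube level and under `P_p` on `X □ ℤ²`, the uniqueness zone and
the linked thick face of the frame sequence `Λˣ` (`Λˣ M = kitCube x`).  The exploration's weighting `W` is a SUBBOX weighting of the
TUBE graph (`IsSubbox (tubeGraph X π) W p D`); this file moves the two estimates to `prodBernoulli W`:
* `innerBoundary_mono_graph`, `zone_anti_graph` — the uniqueness zone only grows when the graph (hence the inner boundary of the cube)
  shrinks, so the zone of the tube graph contains the zone of `X □ ℤ²`;
* `real_cubeEvent_eq` — an event determined by the wires inside the thick cube has the same probability under `prodBernoulli W`, under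
  `P_p` of the tube graph (`IsSubbox.real_eq_bondPercolation`) and under `P_p` of `X □ ℤ²` (`real_eq_of_determinedBy_window`);
* `hIV_of_mem_face` — `hIV` is outright true when the face meets `T ∩ D` (for the contacts near the fibre edge of the window, whose
  faces the caller adds to the target; the loss is `P(o's cluster reaches the collar)`, small by `BoxProdZ2FibreReach`);
* **`kit_hIV`** — given the target route `h3` (F7: `1 - δ² < P_W(linkIn Qt (Λˣ (msel τ)) Ft)`), the conclusion
  `1 - 3δ ≤ P_W(∃ u ∈ kitFace x, P_{W^{π_S}}(u ↔ T inside D) > 1 - δ)` of `KNLevels.stepIV_in`, i.e. literally the last conjunct of the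
  per-level hypothesis of `targetLemma_of_kits` for `σ = kitSData` and the shell `S`.

[cite: KozmaNitzan2024, §4 pp. 19–21 ((21)–(25)) — the ℤ^d model]
-/

noncomputable section

open MeasureTheory

namespace Summit.CriticalPhenomena.PercolationContinuityZ3.Theorems

namespace Transplant

open Literature.Probability.Percolation Literature.Probability.LatticeModels SimpleGraph

/-! ## The uniqueness zone is antitone in the graph -/

section Generic

variable {V : Type*} [DecidableEq V]

/-- The inner vertex boundary grows with the graph. [folklore] -/
theorem innerBoundary_mono_graph {G G' : SimpleGraph V} [G.LocallyFinite] [G'.LocallyFinite] (h : G ≤ G') (Q : Finset V) :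
    innerBoundary G Q ⊆ innerBoundary G' Q := by
  intro x hx
  rw [mem_innerBoundary_iff] at hx ⊢
  obtain ⟨hxQ, y, hy, hxy⟩ := hx
  exact ⟨hxQ, y, hy, h hxy⟩

/-- **The uniqueness zone is antitone in the graph**: with fewer edges the cube has a smaller inner boundary, so fewer pairs are
constrained. [folklore] -/
theorem zone_anti_graph {G G' : SimpleGraph V} [G.LocallyFinite] [G'.LocallyFinite] (h : G ≤ G') (Λ : ℕ → Finset V) (k n : ℕ) :
    UniqZone.zone G' Λ k n ⊆ UniqZone.zone G Λ k n := by
  intro ω hω x hx y hy hbx hby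
  have hsub := innerBoundary_mono_graph h (Λ n)
  obtain ⟨zx, hzx, hcx⟩ := hbx
  obtain ⟨zy, hzy, hcy⟩ := hby
  exact hω x hx y hy ⟨zx, hsub hzx, hcx⟩ ⟨zy, hsub hzy, hcy⟩

omit [DecidableEq V] in
/-- **`hIV` holds outright when the face meets the target inside `D`**: if some `u ∈ face` lies in `T ∩ D` then `u ↔ T inside D` surely,
so the Step-IV event is everything.  (Use: contacts near the fibre edge of the window have no room for the target route `h3`; the
caller puts their faces into an auxiliary target `T_edge ⊆ D`, applies the target lemma to `T ∪ T_edge`, and subtracts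
`P(o ↔ T_edge) ≤ P(o's cluster reaches the collar)`, which is small by `BoxProdZ2FibreReach`.) [folklore] -/
theorem hIV_of_mem_face {W : Sym2 V → unitInterval} {S D T face : Finset V} {δ : ℝ} (hδ : 0 < δ) {u : V}
    (hu : u ∈ face) (huT : u ∈ T) (huD : u ∈ D) :
    1 - 3 * δ ≤ (prodBernoulli W).real {ω | ∃ u ∈ face,
      1 - δ < (prodBernoulli (pinW W (wireSet (↑S : Set V)) ω)).real (⋃ t ∈ T, openConnIn (↑D : Set V) u t)} := by
  have hall : (⋃ t ∈ T, openConnIn (↑D : Set V) u t) = Set.univ :=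
    Set.eq_univ_of_forall fun ω' => Set.mem_biUnion huT ⟨Finset.mem_coe.2 huD, Finset.mem_coe.2 huD, SimpleGraph.Reachable.refl _⟩
  have huniv : {ω : BondConfig V | ∃ u ∈ face,
      1 - δ < (prodBernoulli (pinW W (wireSet (↑S : Set V)) ω)).real (⋃ t ∈ T, openConnIn (↑D : Set V) u t)} = Set.univ := by
    refine Set.eq_univ_of_forall fun ω => ⟨u, hu, ?_⟩
    rw [hall, probReal_univ]; linarith
  rw [huniv, probReal_univ]; linarith

end Generic

namespace BoxProdZ2

open KNLevels KozmaNitzan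
open Literature.Probability.Percolation.GM

variable {W : Type} [DecidableEq W] (X : SimpleGraph W) [X.LocallyFinite]

/-- **Cube events have the same probability under the exploration's weighting and under `P_p` of `X □ ℤ²`**: for a subbox weighting `W`
of the tube graph over `π` on `D` and a set `Q ⊆ D` of vertices with fibres in `π`, every measurable event determined by the wires inside
`Q` has `P_W = P_p^{tube} = P_p^{X □ ℤ²}`. [folklore] -/
theorem real_cubeEvent_eq [Countable W] {π : Finset W} {Wt : Sym2 (W × Site 2) → unitInterval} {p : unitInterval}
    {D Q : Finset (W × Site 2)} (hWD : IsSubbox (tubeGraph X π) Wt p D) (hQD : Q ⊆ D) (hQπ : ∀ v ∈ Q, v.1 ∈ π)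
    {A : Set (BondConfig (W × Site 2))} (hA : DeterminedBy A (wireSet (↑Q : Set (W × Site 2)))) (hAm : MeasurableSet A) :
    (prodBernoulli Wt).real A = (bondPercolation (X □ zdGraph 2) p).real A := by
  rw [hWD.real_eq_bondPercolation (hA.mono (wireSet_mono (Finset.coe_subset.2 hQD))) hAm]
  exact real_eq_of_determinedBy_window X p (hA.mono (wireSet_mono fun v hv => hQπ v (Finset.mem_coe.1 hv))) hAm

/-- **The Step-IV input `hIV` at a candidate contact of the `X □ ℤ²` kit.**  Setting: a subbox weighting `Wt` of the tube graph over
`π = B_X(xe, Rw)` on `D`; the level-`j` kit with planar scale `M` and fibre radius `nF = ψ M` (`ψ = ufatRadius hT V₀`, `ψ M ≤ Rw`); the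
shell `S ⊆ D`; the standard estimates `hstd` of `exists_scales` at `δ²`; a candidate contact `x` with frame `γ` (`γ c ∈ V₀`); and the
target route `h3` from the frame's inner prism `Λˣ (msel τ)` to `Ft ⊆ T` inside `Qt ⊆ D`, `Ft` off the cube.  Conclusion: the `hIV`
clause of `targetLemma_of_kits`. [cite: KozmaNitzan2024, §4 pp. 19–21 ((21)–(25))] -/
theorem kit_hIV [Countable W] {p : unitInterval} (hT : TubeSubcritical X p) (V₀ : Finset W) {δ : ℝ} (hδ : 0 < δ) {msel : W → ℕ}
    {M : ℕ} (hmsel : ∀ τ ∈ V₀, msel τ ≤ M)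
    (hstd : ∀ τ ∈ V₀,
      1 - δ ^ 2 < (bondPercolation (X □ zdGraph 2) p).real (UniqZone.zone (X □ zdGraph 2) (ufatSeq X hT V₀ τ) (msel τ) M) ∧
      ∀ g : HOct 2, 1 - δ ^ 2 < (bondPercolation (X □ zdGraph 2) p).real
        (linkIn (↑(ufatSeq X hT V₀ τ M)) (ufatSeq X hT V₀ τ (msel τ)) (ballFin X τ (ufatRadius X hT V₀ M) ×ˢ piece g M)))
    {xe : W} {Rw : ℕ} (hnF : ufatRadius X hT V₀ M ≤ Rw) {lo hi : Site 2} {j : ℕ}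
    (hwide : ∀ k, (lo - ((j : ℕ) : Site 2)) k + 2 * M + 2 ≤ (hi + ((j : ℕ) : Site 2)) k)
    {Wt : Sym2 (W × Site 2) → unitInterval} {D T : Finset (W × Site 2)} (hWD : IsSubbox (tubeGraph X (ballFin X xe Rw)) Wt p D)
    (hSD : (ballFin X xe Rw) ×ˢ (Finset.Icc ((lo - ((j : ℕ) : Site 2)) + 1) ((hi + ((j : ℕ) : Site 2)) - 1) \
      Finset.Icc ((lo - ((j : ℕ) : Site 2)) + ((2 * M + 2 : ℕ) : Site 2)) ((hi + ((j : ℕ) : Site 2)) - ((2 * M + 2 : ℕ) : Site 2))) ⊆ D)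
    {x : W × Site 2} (hx : x ∈ outerBoundary (tubeGraph X (ballFin X xe Rw)) (tubeLevel (ballFin X xe Rw) lo hi j))
    (γ : X ≃g X) (hγ : γ (fibCtrT X xe Rw (ufatRadius X hT V₀ M) x.1) ∈ V₀)
    {Qt Ft : Finset (W × Site 2)} (hFt : Ft ⊆ T) (hQt : Qt ⊆ D)
    (hfar : Disjoint Ft (kitCube X xe Rw (lo - ((j : ℕ) : Site 2)) (hi + ((j : ℕ) : Site 2)) M (ufatRadius X hT V₀ M) x))
    (h3 : 1 - δ ^ 2 < (prodBernoulli Wt).real (linkIn (↑Qt)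
      (frameSeq X hT V₀ γ (vctr (lo - ((j : ℕ) : Site 2)) (hi + ((j : ℕ) : Site 2)) M
        (pwin (lo - ((j : ℕ) : Site 2)) (hi + ((j : ℕ) : Site 2)) M x.2).1 (pwin (lo - ((j : ℕ) : Site 2)) (hi + ((j : ℕ) : Site 2)) M x.2).2.1
        (pwin (lo - ((j : ℕ) : Site 2)) (hi + ((j : ℕ) : Site 2)) M x.2).2.2) (γ (fibCtrT X xe Rw (ufatRadius X hT V₀ M) x.1))
        (msel (γ (fibCtrT X xe Rw (ufatRadius X hT V₀ M) x.1)))) Ft)) :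
    1 - 3 * δ ≤ (prodBernoulli Wt).real {ω | ∃ u ∈ kitFace X xe Rw (lo - ((j : ℕ) : Site 2)) (hi + ((j : ℕ) : Site 2)) M (ufatRadius X hT V₀ M) x,
      1 - δ < (prodBernoulli (pinW Wt (wireSet (↑((ballFin X xe Rw) ×ˢ (Finset.Icc ((lo - ((j : ℕ) : Site 2)) + 1) ((hi + ((j : ℕ) : Site 2)) - 1) \
        Finset.Icc ((lo - ((j : ℕ) : Site 2)) + ((2 * M + 2 : ℕ) : Site 2)) ((hi + ((j : ℕ) : Site 2)) - ((2 * M + 2 : ℕ) : Site 2)))) :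
          Set (W × Site 2))) ω)).real (⋃ t ∈ T, openConnIn (↑D : Set (W × Site 2)) u t)} := by
  obtain ⟨hcube, h1p, h2p⟩ := stepIV_inputs_at X hT V₀ hstd hwide hx γ hγ
  set v := vctr (lo - ((j : ℕ) : Site 2)) (hi + ((j : ℕ) : Site 2)) M (pwin (lo - ((j : ℕ) : Site 2)) (hi + ((j : ℕ) : Site 2)) M x.2).1
    (pwin (lo - ((j : ℕ) : Site 2)) (hi + ((j : ℕ) : Site 2)) M x.2).2.1 (pwin (lo - ((j : ℕ) : Site 2)) (hi + ((j : ℕ) : Site 2)) M x.2).2.2 with hv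
  set τ := γ (fibCtrT X xe Rw (ufatRadius X hT V₀ M) x.1) with hτ
  set Λ := frameSeq X hT V₀ γ v τ with hΛ
  have hQshell := kitCube_subset_shell (X := X) (xe := xe) (Rw := Rw) (lo := lo) (hi := hi) (j := j) (M := M) hwide hnF hx
  have hQD : kitCube X xe Rw (lo - ((j : ℕ) : Site 2)) (hi + ((j : ℕ) : Site 2)) M (ufatRadius X hT V₀ M) x ⊆ D := hQshell.trans hSD
  have hQπ : ∀ u ∈ kitCube X xe Rw (lo - ((j : ℕ) : Site 2)) (hi + ((j : ℕ) : Site 2)) M (ufatRadius X hT V₀ M) x, u.1 ∈ ballFin X xe Rw :=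
    fun u hu => (Finset.mem_product.1 (hQshell hu)).1
  -- h1 under `prodBernoulli Wt`: subbox + window transfer, then the zone is antitone in the graph
  have h1 : 1 - δ ^ 2 < (prodBernoulli Wt).real (UniqZone.zone (tubeGraph X (ballFin X xe Rw)) Λ (msel τ) M) := by
    rw [real_cubeEvent_eq X hWD hQD hQπ (determinedBy_zone Λ (msel τ) M (by rw [hcube])) (measurableSet_zone Λ (msel τ) M)]
    exact h1p.trans_le (measureReal_mono (zone_anti_graph (tubeGraph_le X (ballFin X xe Rw)) Λ (msel τ) M) (measure_ne_top _ _))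
  -- h2 under `prodBernoulli Wt`
  have h2 : 1 - δ ^ 2 < (prodBernoulli Wt).real (linkIn (↑(Λ M)) (Λ (msel τ))
      (kitFace X xe Rw (lo - ((j : ℕ) : Site 2)) (hi + ((j : ℕ) : Site 2)) M (ufatRadius X hT V₀ M) x)) := by
    rw [hcube, real_cubeEvent_eq X hWD hQD hQπ (determinedBy_linkIn _ _ _ le_rfl) (measurableSet_linkIn _ _ _)]
    exact h2p
  -- Step IV
  have hkn : Λ (msel τ) ⊆ Λ M := frameSeq_mono X hT V₀ γ v τ (hmsel τ hγ)
  have hres := stepIV_in (G := tubeGraph X (ballFin X xe Rw))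
    (S := (ballFin X xe Rw) ×ˢ (Finset.Icc ((lo - ((j : ℕ) : Site 2)) + 1) ((hi + ((j : ℕ) : Site 2)) - 1) \
      Finset.Icc ((lo - ((j : ℕ) : Site 2)) + ((2 * M + 2 : ℕ) : Site 2)) ((hi + ((j : ℕ) : Site 2)) - ((2 * M + 2 : ℕ) : Site 2))))
    hWD hFt hQt Λ hkn (by rw [hcube]; exact hQshell)
    (by rw [hcube]; exact kitFace_subset_innerBoundary_kitCube (X := X) hwide hnF hx) (by rw [hcube]; exact hfar) hδ
    (Rg := (↑D : Set (W × Site 2))) (by rw [hcube]; exact Finset.coe_subset.2 hQD) (Finset.coe_subset.2 hQt) h1 h2 h3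
  exact hres
end BoxProdZ2

end Transplant

end Summit.CriticalPhenomena.PercolationContinuityZ3.Theorems

end
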